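import Literature.MathematicalPhysics.QuantumFieldTheory.Balaban1983to89.Node00.TkNoExpansionAtRecord13
import Literature.MathematicalPhysics.QuantumFieldTheory.Balaban1983to89.Node00.StepWeightsAtNoExpansion
import Summits.QuantumFields.YangMills.Theorems.BalabanUVNodesN11NoExpansionTermFree

/-!
# DAG node N11 — THE POSITIVE HALF OF (S1ᵀ)₁₃ AT ITS FIRST INSTANCE, FOR ANY 𝐓-WEIGHT FAMILY: the all-large-field conjunct of the 𝐓-image §2 form
# at `k = 0` HOLDS as soon as the generation-0 weight factor `ζ_0(T)·w_0(∅,∅,∅)` of the family, read on the averaging graph `V₁ = Ū`, IS def-T's resummed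
# step weight `w(s′)(U, Ū)` up to one constant — the SPEC a witness's residual `ζ0` must meet once FINDING №7's regularity cut is gone

Cell `pub-ymgap`, YM-PLAN Track A (HUMAN RULING D-0062), seat `pub-ymgap-dag-n11-d` (g7; R134 fan-out seat N11 [B14], strategy s2), route `BalabanUVNodes`
rev 19, item K1⁗ `StabilityBAtRecordR13Sep` = stmt-QuantumFields-20290 (helper, count-neutral).  [III] = [Balaban1988Convergent], [I] = [Balaban1987RG1].
Sequel of this seat's `Node00.TkNoExpansionAtRecord13` (p490716: sufficiency of a fibre identity AT 12a's weights `WtOfRecord₁₃`),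
`BalabanUVNodesN11NoExpansionTermFree` (p495297: along the all-large-field history the (2.23) action IS the bare Wilson action, `e^{A_1(s′)(U)} = e^{E−E_1}ρ₀(U)`),
`Node00.StepWeightsAtNoExpansion` (p502303: `0 ≤ w(s′) ≤ 1` at a no-expansion new sequence) and `BalabanUVNodesN11NoTLawAtAnyRegularity` (p517048: FINDING №7 —
at 12a's weights the conjunct is FALSE at every `θ`, because of the factor `χreg_0(Ω₁ᶜ)`).

WHY THIS FILE.  Director-ym LINE №160∕№161 located FINDING №7 at the 12a∕11a junction and adopted the cure F7: node00-def-T's 12a″ `tkWeightsOfRecordP`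
(`ζ_j(Y) := ζ0_j(Y)`, NO regularity factor), node00-def-R's collar-ranged class FILE 22′, then the record editions `Record13CoP`∕`SepCoP` — so the 𝐓-image law
`TLaw₁₃` will be re-read at a NEW weight family `W` and a NEW background map `U`.  This file states, ONCE AND GENERICALLY IN `W` AND `U` (so that 12a″ and the
CoP record instantiate it by `rfl`-faces), what the first instance of N11's residue then demands and WHEN IT HOLDS.  At the all-large-field new sequence `s′`
(`Ω₁(s′) = Λ₁(s′) = ∅`; front factor `χ_1(s′) ≡ 1`) the identity branch of `HasSect2FormTAEZ … 0 U slotT` at `s′` reads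
`T[w(s′)(·,V₁)ρ₀](V₁) = T[ζ_0(T)·w_0(∅,∅,∅)·e^{A_1(s′)(U_1(·,V₁))}](V₁)` for `dV₁`-a.e. `V₁` (11a's one generation = one restricted kernel transport on the full
bond sets, g2∕g3's a.e. face).  When the background map reads the fine field (`U_1(s′)(U, V₁) = U` — print's `U₁ = V₀` on `Ω₁ᶜ = T`, p. 248 L17–20; def-R's
collar-ranged class at `Ω₁ = ∅` has nothing to minimise) the operand is `e^{E(p)−E_1}·ρ₀(U)` for EVERY term-value witness (g4's term-free theorem), so the
identity holds — for the free constant `E_1(s′)` with `c·e^{E(p)−E_1} = 1` — AS SOON AS `ζ_0(T)·w_0(∅,∅,∅)` EQUALS `c·w(s′)(U, Ū)` ON THE GRAPH `V₁ = Ū`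
(g3's `transportK_congr_ae_of_fibre`: two integrand families agreeing on the graph have a.e.-equal transports).  THAT is the spec.  At 12a″ the factor is
`ζ0_0(T)(ω)·e^{−½quad_0(∅)(ω)}`, and 12b's locality law lets `ζ0_0(T)` read the scale-0 variables `ω 0 = (U, 0)` only — exactly enough: the PIN
`ζ0_0(T)(ω) := w(s′)((ω 0).1, avg (ω 0).1)` (the resummation (1.11) p. 248 of ALL the step's characteristic functions at `Ω₁ = ∅`, read on the graph) with
`quad_0(∅) = 0` meets the spec with `c = 1`, `E_1(s′) = E(p)` (§3), is local, and takes values in `[0, 1]` (§4).  K0b's residual of record `ZtOfRecord`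
(`ζ0 ≡ (#{Y})⁻¹`) meets the spec only if `U ↦ w(s′)(U, Ū)` is constant — it is the (3.2)∕(3.3) large-field indicator structure of the step (§2's
hypothesis `hζ` is then an equation `const = c·w(s′)(U,Ū)`); whether the WEAKER a.e. transport identity still holds there is the fibre question this
seat's `…NoExpansionTermFree` §4 isolated and is NOT decided here.

WHAT THIS FILE PROVES (0 `sorry`, 0 `def`, standard axioms; `N`-generic; `θ : Stage13Params F N`, run `p`, ANY `W : TkWeights F N (FluctV N) p.K`, ANY
background family `U`).  §1 `noExpIntegrand_eq_zetaFactor_mul` (the no-expansion integrand of ANY weight family = `(ζ_0(T)·w_0(∅,∅,∅))·Φ` at the two-scale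
configuration); `noExpIntegrand_sect2Operand_of_bg_eq` (with the §2 operand at a background reading the fine field: `(ζ_0(T)·w_0(∅,∅,∅))(U,V₁)·e^{E(p)−E_1}·ρ₀(U)`,
`M ≥ 1`); `sect2Slot_one_ae_eq_transport_of_Omega_empty` (the §2-form slot of ANY `W` at `s′` is a.e. def-T's transport of that integrand; displayed
measurability ∕ bound, `0 < K`).  §2 **`slotsT_one_ae_eq_sect2Slot_of_zetaSpec`** (THE POSITIVE HALF: under the spec `hζ` on the graph, a constant `c > 0`
with `c·e^{E(p)−E_1} = 1`, the background reading the fine field, and the displayed joint measurability ∕ bound of the factor, the (3.25) identity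
`slotT_1(s′)(V₁) = 𝐓_1(s′)e^{A_1(s′)}(V₁)` holds `dV₁`-a.e. — for EVERY term-value witness `t`); `hasSect2FormAtZ_clause_one_of_zetaSpec` (hence the whole
dichotomy clause of `HasSect2FormAtZ` at `s′`); `slotsT_one_ae_eq_sect2Slot_of_zetaSpec_log` (the constant chosen: `E_1(s′) := E(p) + log c`).
§3 **`slotsT_one_ae_eq_sect2Slot_of_zeta0_pin`** (AT A RESIDUAL `Z` whose generation-0 factor the family carries verbatim — `W.ζ 0 T = Z.ζ0 0 T`,
`W.w 0 ∅ ∅ ∅ = e^{−½ Z.quad 0 ∅}`, as 12a″'s `tkWeightsOfRecordP Z` does by `rfl` —: the PIN `ζ0_0(T)(U,V₁) = w(s′)(U,Ū)`, `quad_0(∅) = 0` gives the identity with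
`E_1(s′) = E(p)`, under unity of def-T's residual `ζ` and the displayed joint measurability of `w(s′)`); `hasSect2FormAtZ_clause_one_of_zeta0_pin`.
§4 THE PIN'S LAWS (what 12b asks of a residual at generation 0): `stepWeightPin_pairCfg` (its value at the two-scale configuration), `stepWeightPin_local`
(12b's `LocalLaws` shape: reads `ω 0` only), `stepWeightPin_nonneg` ∕ `stepWeightPin_le_one` (12a's `Laws` shape and the bound `≤ 1`, from unity of `ζ`).

HONEST FRAMING.  Count-neutral kernel bookkeeping on the tree's OWN objects (11a's `TkOfRecord`, def-T's `slotsTOfRecord`∕`wOfRecord`, r11's (2.23) with body);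
the SUFFICIENT half of (S1ᵀ)₁₃'s first instance at ONE new sequence, generic in the weight family and background so that the post-F7 record instantiates it.
It does NOT prove `TLaw₁₃ θ p 0` (the other new sequences, `Ω₁(s′) ≠ ∅`, are [III] Thm 1 ∕ [I] proper — the small-field expansion, not typed), does NOT
construct a witness (K0a's pen; §3–§4 only show the pin is typable within 12b's laws), does NOT decide the conjunct at `ZtOfRecord` after F7, asserts nothing of
Bałaban's.  LOCATED REMARK (not a theorem): the pin of §3 reads the RUN — `w(s′)` carries the thresholds `ε(g₀)`, `δ₀(g₀)` of (3.2)–(3.4) — while a tuple's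
residual `θ.Zt K` is chosen before the run; print's `ζ(Ω₁ᶜ)` (1.11) is run-dependent in the same way.  N11 NOT discharged; counts unmoved (typed 28∕28 ·
discharged 5∕28).  One finite four-torus programme at fixed `ε = L^{−K}`; NOT ℝ⁴, NOT OS, NOT a mass gap, NOT Clay.  Sources: [III] (1.11) p. 248, (2.17)–(2.18)
p. 257, (2.21)–(2.23) p. 258, (3.1)–(3.5) pp. 264–265, (3.16) p. 268, (3.25) p. 270, Theorem p. 245, Thm 1 p. 262; [I] (0.4) p. 253.
-/

noncomputable section

open MeasureTheory
open scoped BigOperators Matrix.Norms.L2Operator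

namespace Summit.QuantumFields.YangMills.Theorems.BalabanUVNodesN11NoExpansionZetaSpec

open Literature.MathematicalPhysics.QuantumFieldTheory.Balaban1983to89 T4Continuum Node00 Node00.Tk DagBinding
open B15DeterminingSets
open BalabanUVNodesN11NoExpansionTermFree (exp_action23_one_eq_rhoZero_of_Omega_empty₁₃)

variable {F : T4Family} {N : ℕ} [NeZero N]

/-! ## §1. GENERIC IN THE WEIGHT FAMILY AND THE BACKGROUND: the no-expansion integrand factored, the operand resolved, the a.e. transport face -/

section Generic

variable (θ : Stage13Params F N) (p : B12.RunParams)

omit [NeZero N] in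
/-- **THE NO-EXPANSION INTEGRAND OF ANY WEIGHT FAMILY, FACTORED**: `ζ_0(T)(ω)·w_0(∅,∅,∅)(ω)` times the operand, at the two-scale configuration
`ω = (U, V₁)` — 11a's one generation of `𝐓_1(s′)` at `Ω₁(s′) = ∅` ((2.22): no fluctuation integral). [cite: Balaban1988Convergent, (2.21)–(2.22) p.258, (2.18) p.257] -/
theorem noExpIntegrand_eq_zetaFactor_mul (W : TkWeights F N (FluctV N) p.K)
    (Φ : SFluct (F.P p.K) (FluctV N) → MSField (F.P p.K) (SU N) → ℝ) (V1 : GaugeField (F.P p.K) 1 (SU N)) (Uf : GaugeField (F.P p.K) 0 (SU N)) :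
    noExpIntegrand F N (FluctV N) p.K W Φ V1 Uf =
      (W.ζ 0 Set.univ (pairCfg (V := FluctV N) V1 Uf) * W.w 0 ∅ ∅ ∅ (pairCfg (V := FluctV N) V1 Uf)) *
        Φ (fun _ => ∅, fun j => (pairCfg (V := FluctV N) V1 Uf j).2) (fun j => (pairCfg (V := FluctV N) V1 Uf j).1) := by
  unfold noExpIntegrand
  rw [mul_assoc]

/-- **… WITH THE §2 OPERAND AT A BACKGROUND MAP READING THE FINE FIELD**: if `U_1(s′)` returns the scale-0 variables at the two-scale configuration
(print's `U₁ = V₀` on `Ω₁ᶜ = T`), the integrand is `(ζ_0(T)·w_0(∅,∅,∅))(U,V₁) · e^{E(p) − E_1} · ρ₀(U)` for EVERY term-value witness (`M ≥ 1`; this seat's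
`exp_action23_one_eq_rhoZero_of_Omega_empty₁₃`). [cite: Balaban1988Convergent, (1.11) p.248, (2.18) p.257, (2.23) p.258, Thm 1 p.262] -/
theorem noExpIntegrand_sect2Operand_of_bg_eq (hM : 1 ≤ θ.τ9.M)
    (s : SeqOfRecord F θ.ν θ.τ9.M (gOfRecord₁₃ F N θ p) p.K 1) (hΩ : s.Ω 1 = ∅) (W : TkWeights F N (FluctV N) p.K)
    (t : Sect2.TermValues (F.P p.K) (MatA N) (FluctV N) θ.τ9.M) (Ek : ℝ) (U : BgMap F N p.K)
    (V1 : GaugeField (F.P p.K) 1 (SU N)) (Uf : GaugeField (F.P p.K) 0 (SU N))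
    (hU : U (fun j => (pairCfg (V := FluctV N) V1 Uf j).1) = Uf) :
    noExpIntegrand F N (FluctV N) p.K W (sect2Operand F N (FluctV N) p.K (settingOfRecord₁₃ F N θ p) (θ.Rz p.K) s t Ek U) V1 Uf =
      (W.ζ 0 Set.univ (pairCfg (V := FluctV N) V1 Uf) * W.w 0 ∅ ∅ ∅ (pairCfg (V := FluctV N) V1 Uf)) *
        (Real.exp (EOfRecord₁₃ F N θ p - Ek) * rhoZeroOfRecord F N p.K p.g0 (EOfRecord₁₃ F N θ p) Uf) := by
  rw [noExpIntegrand_eq_zetaFactor_mul]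
  congr 1
  show Real.exp ((sect2ActionDataOfRecord F N (FluctV N) p.K (settingOfRecord₁₃ F N θ p) (θ.Rz p.K) s t
    (fun _ => ∅, fun j => (pairCfg (V := FluctV N) V1 Uf j).2) Ek).action23 1 (U fun j => (pairCfg (V := FluctV N) V1 Uf j).1)) = _
  rw [hU]
  exact exp_action23_one_eq_rhoZero_of_Omega_empty₁₃ θ p hM s hΩ t _ Ek Uf

/-- **THE §2-FORM SLOT OF ANY WEIGHT FAMILY AT THE ALL-LARGE-FIELD SEQUENCE IS A.E. def-T's TRANSPORT OF ITS NO-EXPANSION INTEGRAND** (`0 < K`; the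
integrand family jointly measurable and bounded — displayed; g2∕g3's full-bond-set face `TkOfRecord_one_ae_eq_transportOfRecord_of_Omega_empty`).
[cite: Balaban1988Convergent, (2.18) p.257, (3.1) p.264, (3.25) p.270] -/
theorem sect2Slot_one_ae_eq_transport_of_Omega_empty (hK : 0 < p.K)
    (s : SeqOfRecord F θ.ν θ.τ9.M (gOfRecord₁₃ F N θ p) p.K 1) (hΩ : s.Ω 1 = ∅) (W : TkWeights F N (FluctV N) p.K)
    (t : Sect2.TermValues (F.P p.K) (MatA N) (FluctV N) θ.τ9.M) (Ek : ℝ) (U : BgMap F N p.K) {C : ℝ}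
    (hm : Measurable (Function.uncurry (noExpIntegrand F N (FluctV N) p.K W
      (sect2Operand F N (FluctV N) p.K (settingOfRecord₁₃ F N θ p) (θ.Rz p.K) s t Ek U))))
    (hC : ∀ V1 Uf, |noExpIntegrand F N (FluctV N) p.K W
      (sect2Operand F N (FluctV N) p.K (settingOfRecord₁₃ F N θ p) (θ.Rz p.K) s t Ek U) V1 Uf| ≤ C) :
    sect2Slot F N (FluctV N) p.K (settingOfRecord₁₃ F N θ p) (θ.Rz p.K) W s t Ek U =ᵐ[fieldMeasure (F.P p.K) 1 (SU N)]
      fun V1 => transportOfRecord F N p.K 0 (noExpIntegrand F N (FluctV N) p.K W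
        (sect2Operand F N (FluctV N) p.K (settingOfRecord₁₃ F N θ p) (θ.Rz p.K) s t Ek U) V1) V1 :=
  TkOfRecord_one_ae_eq_transportOfRecord_of_Omega_empty θ.ν θ.τ9.M _ hK W s hΩ _ hm hC

end Generic

/-! ## §2. THE POSITIVE HALF: the (3.25) identity at the all-large-field sequence FROM THE ζ-SPEC on the averaging graph -/

section Positive

variable (θ : Stage13Params F N) (p : B12.RunParams)

/-- **THE FIRST (S1ᵀ)₁₃ IDENTITY HOLDS UNDER THE ζ-SPEC, FOR ANY WEIGHT FAMILY AND ANY TERM-VALUE WITNESS.**  Let `s′` be the all-large-field new sequence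
(`Ω₁(s′) = ∅`), `W` any 𝐓-weight family, `U_1` a background family whose member at `s′` reads the fine field at every two-scale configuration, and suppose
the generation-0 factor of `W` meets THE SPEC on the averaging graph: `ζ_0(T)(U,Ū)·w_0(∅,∅,∅)(U,Ū) = c·w(s′)(U,Ū)` for every fine field `U`, with a constant
`c` and a constant `E_1` such that `c·e^{E(p) − E_1} = 1`; suppose the factor is jointly measurable in `(V₁, U)` and bounded (displayed).  Then (`0 < K`, `M ≥ 1`)
`slotT_1(s′)(V₁) = 𝐓_1(s′) e^{A_1(s′)}(V₁)` for `dV₁`-a.e. `V₁` — def-T's pre-𝐑 slot of record EQUALS 11a's §2-form slot of `W` read with `(t, E_1, U_1(s′))`.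
Proof: both sides are one-step transports of record (`slotsTOfRecord_one_apply`; §1), and their integrands agree on the graph `V₁ = Ū` by the spec and the
term-free operand, so g3's `transportK_congr_ae_of_fibre` applies. [cite: Balaban1988Convergent, (3.25) p.270, Theorem p.245, (1.11) p.248, (3.1) p.264, (2.18) p.257] -/
theorem slotsT_one_ae_eq_sect2Slot_of_zetaSpec (hK : 0 < p.K) (hM : 1 ≤ θ.τ9.M)
    (s : SeqOfRecord F θ.ν θ.τ9.M (gOfRecord₁₃ F N θ p) p.K 1) (hΩ : s.Ω 1 = ∅) (W : TkWeights F N (FluctV N) p.K)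
    (t : Sect2.TermValues (F.P p.K) (MatA N) (FluctV N) θ.τ9.M) (U : BgMap F N p.K)
    (hU : ∀ (V1 : GaugeField (F.P p.K) 1 (SU N)) (Uf : GaugeField (F.P p.K) 0 (SU N)), U (fun j => (pairCfg (V := FluctV N) V1 Uf j).1) = Uf)
    {c Ek B : ℝ} (hcE : c * Real.exp (EOfRecord₁₃ F N θ p - Ek) = 1)
    (hζ : ∀ Uf : GaugeField (F.P p.K) 0 (SU N),
      W.ζ 0 Set.univ (pairCfg (V := FluctV N) ((avOfRecord F N p.K 0).avg Uf) Uf) *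
          W.w 0 ∅ ∅ ∅ (pairCfg (V := FluctV N) ((avOfRecord F N p.K 0).avg Uf) Uf) =
        c * wOfRecord₉ F N θ.toStage9Params p (gOfRecord₁₃ F N θ p) 0 s Uf ((avOfRecord F N p.K 0).avg Uf))
    (hm : Measurable (Function.uncurry fun (V1 : GaugeField (F.P p.K) 1 (SU N)) (Uf : GaugeField (F.P p.K) 0 (SU N)) =>
      W.ζ 0 Set.univ (pairCfg (V := FluctV N) V1 Uf) * W.w 0 ∅ ∅ ∅ (pairCfg (V := FluctV N) V1 Uf)))
    (hB : ∀ (V1 : GaugeField (F.P p.K) 1 (SU N)) (Uf : GaugeField (F.P p.K) 0 (SU N)),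
      |W.ζ 0 Set.univ (pairCfg (V := FluctV N) V1 Uf) * W.w 0 ∅ ∅ ∅ (pairCfg (V := FluctV N) V1 Uf)| ≤ B) :
    ∀ᵐ V1 ∂fieldMeasure (F.P p.K) 1 (SU N),
      chiSeqOfRecord F N θ.ν θ.τ9.M (gOfRecord₁₃ F N θ p) p.K 1 s V1 ≠ 0 →
        slotsTOfRecord F N θ.ν θ.τ9 (EOfRecord₁₃ F N θ) (wOfRecord₉ F N θ.toStage9Params) θ.ppSel p
            (gOfRecord₁₃ F N θ p) 1 s V1 =
          sect2Slot F N (FluctV N) p.K (settingOfRecord₁₃ F N θ p) (θ.Rz p.K) W s t Ek U V1 := by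
  -- the integrand in closed form at every two-scale configuration (background resolved, operand term-free)
  have hint : ∀ (V1 : GaugeField (F.P p.K) 1 (SU N)) (Uf : GaugeField (F.P p.K) 0 (SU N)),
      noExpIntegrand F N (FluctV N) p.K W (sect2Operand F N (FluctV N) p.K (settingOfRecord₁₃ F N θ p) (θ.Rz p.K) s t Ek U) V1 Uf =
        (W.ζ 0 Set.univ (pairCfg (V := FluctV N) V1 Uf) * W.w 0 ∅ ∅ ∅ (pairCfg (V := FluctV N) V1 Uf)) *
          (Real.exp (EOfRecord₁₃ F N θ p - Ek) * rhoZeroOfRecord F N p.K p.g0 (EOfRecord₁₃ F N θ p) Uf) :=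
    fun V1 Uf => noExpIntegrand_sect2Operand_of_bg_eq θ p hM s hΩ W t Ek U V1 Uf (hU V1 Uf)
  have hfun : Function.uncurry (noExpIntegrand F N (FluctV N) p.K W
        (sect2Operand F N (FluctV N) p.K (settingOfRecord₁₃ F N θ p) (θ.Rz p.K) s t Ek U)) =
      fun z => (Function.uncurry (fun (V1 : GaugeField (F.P p.K) 1 (SU N)) (Uf : GaugeField (F.P p.K) 0 (SU N)) =>
          W.ζ 0 Set.univ (pairCfg (V := FluctV N) V1 Uf) * W.w 0 ∅ ∅ ∅ (pairCfg (V := FluctV N) V1 Uf)) z) *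
        (Real.exp (EOfRecord₁₃ F N θ p - Ek) * rhoZeroOfRecord F N p.K p.g0 (EOfRecord₁₃ F N θ p) z.2) := by
    funext z
    rcases z with ⟨V1, Uf⟩
    exact hint V1 Uf
  -- the displayed measurability ∕ bound of the factor give those of the integrand
  have hm' : Measurable (Function.uncurry (noExpIntegrand F N (FluctV N) p.K W
      (sect2Operand F N (FluctV N) p.K (settingOfRecord₁₃ F N θ p) (θ.Rz p.K) s t Ek U))) := by
    rw [hfun]
    exact hm.mul (measurable_const.mul ((measurable_rhoZeroOfRecord F N p.K p.g0 (EOfRecord₁₃ F N θ p)).comp measurable_snd))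
  have hC' : ∀ (V1 : GaugeField (F.P p.K) 1 (SU N)) (Uf : GaugeField (F.P p.K) 0 (SU N)),
      |noExpIntegrand F N (FluctV N) p.K W (sect2Operand F N (FluctV N) p.K (settingOfRecord₁₃ F N θ p) (θ.Rz p.K) s t Ek U) V1 Uf| ≤
        B * (Real.exp (EOfRecord₁₃ F N θ p - Ek) * Real.exp (-EOfRecord₁₃ F N θ p)) := by
    intro V1 Uf
    rw [hint V1 Uf, abs_mul]
    have hB0 : 0 ≤ B := (abs_nonneg _).trans (hB V1 Uf)
    have hρ : |Real.exp (EOfRecord₁₃ F N θ p - Ek) * rhoZeroOfRecord F N p.K p.g0 (EOfRecord₁₃ F N θ p) Uf| ≤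
        Real.exp (EOfRecord₁₃ F N θ p - Ek) * Real.exp (-EOfRecord₁₃ F N θ p) := by
      rw [abs_mul, abs_of_pos (Real.exp_pos _), abs_of_pos (rhoZeroOfRecord_pos F N p.K p.g0 _ Uf)]
      exact mul_le_mul_of_nonneg_left (rhoZeroOfRecord_le F N p.K p.g0 _ Uf) (Real.exp_pos _).le
    exact mul_le_mul (hB V1 Uf) hρ (abs_nonneg _) hB0
  -- the fibre identity on the graph `V₁ = Ū`: the spec, the term-free operand, `c·e^{E−E_1} = 1`
  have h0 : gOfRecord₁₃ F N θ p 0 = p.g0 := FlowStepRuns.genSeq_zero _ _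
  have hfib : ∀ Uf : GaugeField (F.P p.K) 0 (SU N),
      wOfRecord₉ F N θ.toStage9Params p (gOfRecord₁₃ F N θ p) 0 s Uf ((avOfRecord F N p.K 0).avg Uf) *
          rhoZeroOfRecord F N p.K (gOfRecord₁₃ F N θ p 0) (EOfRecord₁₃ F N θ p) Uf =
        noExpIntegrand F N (FluctV N) p.K W
          (sect2Operand F N (FluctV N) p.K (settingOfRecord₁₃ F N θ p) (θ.Rz p.K) s t Ek U) ((avOfRecord F N p.K 0).avg Uf) Uf := by
    intro Uf
    rw [hint, hζ Uf, h0]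
    calc wOfRecord₉ F N θ.toStage9Params p (gOfRecord₁₃ F N θ p) 0 s Uf ((avOfRecord F N p.K 0).avg Uf) *
          rhoZeroOfRecord F N p.K p.g0 (EOfRecord₁₃ F N θ p) Uf
        = (c * Real.exp (EOfRecord₁₃ F N θ p - Ek)) *
            (wOfRecord₉ F N θ.toStage9Params p (gOfRecord₁₃ F N θ p) 0 s Uf ((avOfRecord F N p.K 0).avg Uf) *
              rhoZeroOfRecord F N p.K p.g0 (EOfRecord₁₃ F N θ p) Uf) := by rw [hcE, one_mul]
      _ = c * wOfRecord₉ F N θ.toStage9Params p (gOfRecord₁₃ F N θ p) 0 s Uf ((avOfRecord F N p.K 0).avg Uf) *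
            (Real.exp (EOfRecord₁₃ F N θ p - Ek) * rhoZeroOfRecord F N p.K p.g0 (EOfRecord₁₃ F N θ p) Uf) := by ring
  have h1 := transportK_congr_ae_of_fibre (avOfRecord_measurable F N p.K 0) (avOfRecord_haarAC F N p.K 0 hK)
    (f := fun V1 Uf => wOfRecord₉ F N θ.toStage9Params p (gOfRecord₁₃ F N θ p) 0 s Uf V1 *
      rhoZeroOfRecord F N p.K (gOfRecord₁₃ F N θ p 0) (EOfRecord₁₃ F N θ p) Uf)
    (g := noExpIntegrand F N (FluctV N) p.K W
      (sect2Operand F N (FluctV N) p.K (settingOfRecord₁₃ F N θ p) (θ.Rz p.K) s t Ek U)) hfib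
  have h2 := sect2Slot_one_ae_eq_transport_of_Omega_empty θ p hK s hΩ W t Ek U hm' hC'
  filter_upwards [h1, h2] with V1 e1 e2 _
  rw [slotsTOfRecord_one_apply, e2]
  exact e1

/-- **… HENCE THE WHOLE DICHOTOMY CLAUSE OF `HasSect2FormAtZ` AT `s′`** (identity branch) under the ζ-spec — the conjunct the 𝐓-image §2-form predicate
`HasSect2FormTAEZ … 0 U_1 slotT` asks of the all-large-field new sequence, for the witness `(t, E_1)`. [cite: Balaban1988Convergent, (2.17)–(2.18) p.257, (3.25) p.270] -/
theorem hasSect2FormAtZ_clause_one_of_zetaSpec (hK : 0 < p.K) (hM : 1 ≤ θ.τ9.M)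
    (s : SeqOfRecord F θ.ν θ.τ9.M (gOfRecord₁₃ F N θ p) p.K 1) (hΩ : s.Ω 1 = ∅) (W : TkWeights F N (FluctV N) p.K)
    (t : Sect2.TermValues (F.P p.K) (MatA N) (FluctV N) θ.τ9.M) (U : BgMap F N p.K)
    (hU : ∀ (V1 : GaugeField (F.P p.K) 1 (SU N)) (Uf : GaugeField (F.P p.K) 0 (SU N)), U (fun j => (pairCfg (V := FluctV N) V1 Uf j).1) = Uf)
    {c Ek B : ℝ} (hcE : c * Real.exp (EOfRecord₁₃ F N θ p - Ek) = 1)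
    (hζ : ∀ Uf : GaugeField (F.P p.K) 0 (SU N),
      W.ζ 0 Set.univ (pairCfg (V := FluctV N) ((avOfRecord F N p.K 0).avg Uf) Uf) *
          W.w 0 ∅ ∅ ∅ (pairCfg (V := FluctV N) ((avOfRecord F N p.K 0).avg Uf) Uf) =
        c * wOfRecord₉ F N θ.toStage9Params p (gOfRecord₁₃ F N θ p) 0 s Uf ((avOfRecord F N p.K 0).avg Uf))
    (hm : Measurable (Function.uncurry fun (V1 : GaugeField (F.P p.K) 1 (SU N)) (Uf : GaugeField (F.P p.K) 0 (SU N)) =>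
      W.ζ 0 Set.univ (pairCfg (V := FluctV N) V1 Uf) * W.w 0 ∅ ∅ ∅ (pairCfg (V := FluctV N) V1 Uf)))
    (hB : ∀ (V1 : GaugeField (F.P p.K) 1 (SU N)) (Uf : GaugeField (F.P p.K) 0 (SU N)),
      |W.ζ 0 Set.univ (pairCfg (V := FluctV N) V1 Uf) * W.w 0 ∅ ∅ ∅ (pairCfg (V := FluctV N) V1 Uf)| ≤ B) :
    slotsTOfRecord F N θ.ν θ.τ9 (EOfRecord₁₃ F N θ) (wOfRecord₉ F N θ.toStage9Params) θ.ppSel p (gOfRecord₁₃ F N θ p) 1 s = 0 ∨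
      ∀ᵐ V1 ∂fieldMeasure (F.P p.K) 1 (SU N),
        chiSeqOfRecord F N θ.ν θ.τ9.M (gOfRecord₁₃ F N θ p) p.K 1 s V1 ≠ 0 →
          slotsTOfRecord F N θ.ν θ.τ9 (EOfRecord₁₃ F N θ) (wOfRecord₉ F N θ.toStage9Params) θ.ppSel p
              (gOfRecord₁₃ F N θ p) 1 s V1 =
            sect2Slot F N (FluctV N) p.K (settingOfRecord₁₃ F N θ p) (θ.Rz p.K) W s t Ek U V1 :=
  Or.inr (slotsT_one_ae_eq_sect2Slot_of_zetaSpec θ p hK hM s hΩ W t U hU hcE hζ hm hB)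

/-- **THE CONSTANT CHOSEN**: with `E_1(s′) := E(p) + log c` (`c > 0`) the normalisation `c·e^{E(p) − E_1} = 1` holds, so the spec with constant `c` gives the
identity at that `E_1`. [cite: Balaban1988Convergent, (2.24) p.258, (3.25) p.270] -/
theorem slotsT_one_ae_eq_sect2Slot_of_zetaSpec_log (hK : 0 < p.K) (hM : 1 ≤ θ.τ9.M)
    (s : SeqOfRecord F θ.ν θ.τ9.M (gOfRecord₁₃ F N θ p) p.K 1) (hΩ : s.Ω 1 = ∅) (W : TkWeights F N (FluctV N) p.K)
    (t : Sect2.TermValues (F.P p.K) (MatA N) (FluctV N) θ.τ9.M) (U : BgMap F N p.K)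
    (hU : ∀ (V1 : GaugeField (F.P p.K) 1 (SU N)) (Uf : GaugeField (F.P p.K) 0 (SU N)), U (fun j => (pairCfg (V := FluctV N) V1 Uf j).1) = Uf)
    {c B : ℝ} (hc : 0 < c)
    (hζ : ∀ Uf : GaugeField (F.P p.K) 0 (SU N),
      W.ζ 0 Set.univ (pairCfg (V := FluctV N) ((avOfRecord F N p.K 0).avg Uf) Uf) *
          W.w 0 ∅ ∅ ∅ (pairCfg (V := FluctV N) ((avOfRecord F N p.K 0).avg Uf) Uf) =
        c * wOfRecord₉ F N θ.toStage9Params p (gOfRecord₁₃ F N θ p) 0 s Uf ((avOfRecord F N p.K 0).avg Uf))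
    (hm : Measurable (Function.uncurry fun (V1 : GaugeField (F.P p.K) 1 (SU N)) (Uf : GaugeField (F.P p.K) 0 (SU N)) =>
      W.ζ 0 Set.univ (pairCfg (V := FluctV N) V1 Uf) * W.w 0 ∅ ∅ ∅ (pairCfg (V := FluctV N) V1 Uf)))
    (hB : ∀ (V1 : GaugeField (F.P p.K) 1 (SU N)) (Uf : GaugeField (F.P p.K) 0 (SU N)),
      |W.ζ 0 Set.univ (pairCfg (V := FluctV N) V1 Uf) * W.w 0 ∅ ∅ ∅ (pairCfg (V := FluctV N) V1 Uf)| ≤ B) :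
    ∀ᵐ V1 ∂fieldMeasure (F.P p.K) 1 (SU N),
      chiSeqOfRecord F N θ.ν θ.τ9.M (gOfRecord₁₃ F N θ p) p.K 1 s V1 ≠ 0 →
        slotsTOfRecord F N θ.ν θ.τ9 (EOfRecord₁₃ F N θ) (wOfRecord₉ F N θ.toStage9Params) θ.ppSel p
            (gOfRecord₁₃ F N θ p) 1 s V1 =
          sect2Slot F N (FluctV N) p.K (settingOfRecord₁₃ F N θ p) (θ.Rz p.K) W s t (EOfRecord₁₃ F N θ p + Real.log c) U V1 := by
  refine slotsT_one_ae_eq_sect2Slot_of_zetaSpec θ p hK hM s hΩ W t U hU ?_ hζ hm hB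
  rw [show EOfRecord₁₃ F N θ p - (EOfRecord₁₃ F N θ p + Real.log c) = -Real.log c by ring, Real.exp_neg, Real.exp_log hc,
    mul_inv_cancel₀ hc.ne']

end Positive

/-! ## §3. AT A RESIDUAL WHOSE GENERATION-0 FACTOR THE FAMILY CARRIES VERBATIM (12a″'s shape): the PIN `ζ0_0(T) := w(s′)(U, Ū)`, `quad_0(∅) = 0` -/

section Pin

variable (θ : Stage13Params F N) (p : B12.RunParams)

/-- **THE PIN MEETS THE SPEC AND GIVES THE FIRST (S1ᵀ)₁₃ IDENTITY WITH `E_1(s′) = E(p)`.**  Let `W` carry a residual `Z`'s generation-0 factor verbatim —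
`W.ζ 0 T = Z.ζ0 0 T` and `W.w 0 ∅ ∅ ∅ = e^{−½ Z.quad 0 ∅}` (12a″'s `tkWeightsOfRecordP Z`: `ζ := ζ0` with NO regularity factor, `χ(∅,∅) = 1`) —, let the
background at `s′` read the fine field, and let `Z` be PINNED at generation 0 on `T` by def-T's resummed step weight on the averaging graph,
`ζ0_0(T)(U, V₁) = w(s′)(U, Ū)` (a function of the scale-0 variables only), with the Gaussian placeholder `quad_0(∅) = 0` there.  Then, under unity of the
residual fluctuation factor `ζ` of def-T's labels (`0 ≤ w(s′) ≤ 1`) and the displayed joint measurability of `w(s′)` (the `measω` row via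
`measurable_wOfRecord`), `slotT_1(s′) = 𝐓_1(s′)e^{A_1(s′)}` `dV₁`-a.e. for EVERY term-value witness, at the constant `E_1(s′) = E(p)` (`0 < K`, `M ≥ 1`).
[cite: Balaban1988Convergent, (1.11) p.248, (3.16) p.268, (3.25) p.270, Theorem p.245, (2.21) p.258] -/
theorem slotsT_one_ae_eq_sect2Slot_of_zeta0_pin (hK : 0 < p.K) (hM : 1 ≤ θ.τ9.M) (hζu : IsZetaUnity F N θ.ν θ.τ9.M θ.ζ)
    (s : SeqOfRecord F θ.ν θ.τ9.M (gOfRecord₁₃ F N θ p) p.K 1) (hΩ : s.Ω 1 = ∅) (W : TkWeights F N (FluctV N) p.K)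
    (t : Sect2.TermValues (F.P p.K) (MatA N) (FluctV N) θ.τ9.M) (U : BgMap F N p.K)
    (hU : ∀ (V1 : GaugeField (F.P p.K) 1 (SU N)) (Uf : GaugeField (F.P p.K) 0 (SU N)), U (fun j => (pairCfg (V := FluctV N) V1 Uf j).1) = Uf)
    (Z : TkResidualW F N (FluctV N) p.K)
    (hWζ : ∀ ω : MultiCfg (F.P p.K) (SU N) (FluctV N), W.ζ 0 Set.univ ω = Z.ζ0 0 Set.univ ω)
    (hWw : ∀ ω : MultiCfg (F.P p.K) (SU N) (FluctV N), W.w 0 ∅ ∅ ∅ ω = Real.exp (-(1 / 2 : ℝ) * Z.quad 0 ∅ ω))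
    (hZ : ∀ (V1 : GaugeField (F.P p.K) 1 (SU N)) (Uf : GaugeField (F.P p.K) 0 (SU N)),
      Z.ζ0 0 Set.univ (pairCfg (V := FluctV N) V1 Uf) = wOfRecord₉ F N θ.toStage9Params p (gOfRecord₁₃ F N θ p) 0 s Uf ((avOfRecord F N p.K 0).avg Uf))
    (hq : ∀ (V1 : GaugeField (F.P p.K) 1 (SU N)) (Uf : GaugeField (F.P p.K) 0 (SU N)), Z.quad 0 ∅ (pairCfg (V := FluctV N) V1 Uf) = 0)
    (hmw : Measurable fun z : GaugeField (F.P p.K) 1 (SU N) × GaugeField (F.P p.K) 0 (SU N) =>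
      wOfRecord₉ F N θ.toStage9Params p (gOfRecord₁₃ F N θ p) 0 s z.2 z.1) :
    ∀ᵐ V1 ∂fieldMeasure (F.P p.K) 1 (SU N),
      chiSeqOfRecord F N θ.ν θ.τ9.M (gOfRecord₁₃ F N θ p) p.K 1 s V1 ≠ 0 →
        slotsTOfRecord F N θ.ν θ.τ9 (EOfRecord₁₃ F N θ) (wOfRecord₉ F N θ.toStage9Params) θ.ppSel p
            (gOfRecord₁₃ F N θ p) 1 s V1 =
          sect2Slot F N (FluctV N) p.K (settingOfRecord₁₃ F N θ p) (θ.Rz p.K) W s t (EOfRecord₁₃ F N θ p) U V1 := by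
  -- the generation-0 factor of `W` at the two-scale configuration IS `w(s′)(U, Ū)`
  have hfac : ∀ (V1 : GaugeField (F.P p.K) 1 (SU N)) (Uf : GaugeField (F.P p.K) 0 (SU N)),
      W.ζ 0 Set.univ (pairCfg (V := FluctV N) V1 Uf) * W.w 0 ∅ ∅ ∅ (pairCfg (V := FluctV N) V1 Uf) =
        wOfRecord₉ F N θ.toStage9Params p (gOfRecord₁₃ F N θ p) 0 s Uf ((avOfRecord F N p.K 0).avg Uf) := by
    intro V1 Uf
    rw [hWζ, hWw, hZ, hq, mul_zero, Real.exp_zero, mul_one]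
  refine slotsT_one_ae_eq_sect2Slot_of_zetaSpec θ p hK hM s hΩ W t U hU (c := 1) (B := 1) ?_ ?_ ?_ ?_
  · rw [sub_self, Real.exp_zero, mul_one]
  · intro Uf
    rw [hfac, one_mul]
  · have heq : (Function.uncurry fun (V1 : GaugeField (F.P p.K) 1 (SU N)) (Uf : GaugeField (F.P p.K) 0 (SU N)) =>
        W.ζ 0 Set.univ (pairCfg (V := FluctV N) V1 Uf) * W.w 0 ∅ ∅ ∅ (pairCfg (V := FluctV N) V1 Uf)) =
        fun z : GaugeField (F.P p.K) 1 (SU N) × GaugeField (F.P p.K) 0 (SU N) =>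
          wOfRecord₉ F N θ.toStage9Params p (gOfRecord₁₃ F N θ p) 0 s z.2 ((avOfRecord F N p.K 0).avg z.2) := by
      funext z
      rcases z with ⟨V1, Uf⟩
      exact hfac V1 Uf
    rw [heq]
    have hg : Measurable fun Uf : GaugeField (F.P p.K) 0 (SU N) =>
        (((avOfRecord F N p.K 0).avg Uf, Uf) : GaugeField (F.P p.K) 1 (SU N) × GaugeField (F.P p.K) 0 (SU N)) :=
      (avOfRecord_measurable F N p.K 0).prodMk measurable_id
    have hgraph : Measurable fun Uf : GaugeField (F.P p.K) 0 (SU N) =>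
        wOfRecord₉ F N θ.toStage9Params p (gOfRecord₁₃ F N θ p) 0 s Uf ((avOfRecord F N p.K 0).avg Uf) := by
      simpa only [Function.comp_def] using hmw.comp hg
    exact hgraph.comp measurable_snd
  · intro V1 Uf
    rw [hfac]
    have h0 : 0 ≤ wOfRecord₉ F N θ.toStage9Params p (gOfRecord₁₃ F N θ p) 0 s Uf ((avOfRecord F N p.K 0).avg Uf) :=
      wOfRecord_nonneg_of_Omega_empty F N θ.ν θ.τ9.M θ.A₁ p (gOfRecord₁₃ F N θ p) 0 hζu s hΩ Uf ((avOfRecord F N p.K 0).avg Uf)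
    have h1 : wOfRecord₉ F N θ.toStage9Params p (gOfRecord₁₃ F N θ p) 0 s Uf ((avOfRecord F N p.K 0).avg Uf) ≤ 1 :=
      wOfRecord_le_one_of_Omega_empty F N θ.ν θ.τ9.M θ.A₁ p (gOfRecord₁₃ F N θ p) 0 hζu s hΩ Uf ((avOfRecord F N p.K 0).avg Uf)
    rw [abs_of_nonneg h0]
    exact h1

/-- **… HENCE THE DICHOTOMY CLAUSE OF `HasSect2FormAtZ` AT `s′` under the pin** (identity branch, `E_1(s′) = E(p)`). [cite: Balaban1988Convergent, (2.17)–(2.18) p.257, (3.25) p.270] -/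
theorem hasSect2FormAtZ_clause_one_of_zeta0_pin (hK : 0 < p.K) (hM : 1 ≤ θ.τ9.M) (hζu : IsZetaUnity F N θ.ν θ.τ9.M θ.ζ)
    (s : SeqOfRecord F θ.ν θ.τ9.M (gOfRecord₁₃ F N θ p) p.K 1) (hΩ : s.Ω 1 = ∅) (W : TkWeights F N (FluctV N) p.K)
    (t : Sect2.TermValues (F.P p.K) (MatA N) (FluctV N) θ.τ9.M) (U : BgMap F N p.K)
    (hU : ∀ (V1 : GaugeField (F.P p.K) 1 (SU N)) (Uf : GaugeField (F.P p.K) 0 (SU N)), U (fun j => (pairCfg (V := FluctV N) V1 Uf j).1) = Uf)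
    (Z : TkResidualW F N (FluctV N) p.K)
    (hWζ : ∀ ω : MultiCfg (F.P p.K) (SU N) (FluctV N), W.ζ 0 Set.univ ω = Z.ζ0 0 Set.univ ω)
    (hWw : ∀ ω : MultiCfg (F.P p.K) (SU N) (FluctV N), W.w 0 ∅ ∅ ∅ ω = Real.exp (-(1 / 2 : ℝ) * Z.quad 0 ∅ ω))
    (hZ : ∀ (V1 : GaugeField (F.P p.K) 1 (SU N)) (Uf : GaugeField (F.P p.K) 0 (SU N)),
      Z.ζ0 0 Set.univ (pairCfg (V := FluctV N) V1 Uf) = wOfRecord₉ F N θ.toStage9Params p (gOfRecord₁₃ F N θ p) 0 s Uf ((avOfRecord F N p.K 0).avg Uf))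
    (hq : ∀ (V1 : GaugeField (F.P p.K) 1 (SU N)) (Uf : GaugeField (F.P p.K) 0 (SU N)), Z.quad 0 ∅ (pairCfg (V := FluctV N) V1 Uf) = 0)
    (hmw : Measurable fun z : GaugeField (F.P p.K) 1 (SU N) × GaugeField (F.P p.K) 0 (SU N) =>
      wOfRecord₉ F N θ.toStage9Params p (gOfRecord₁₃ F N θ p) 0 s z.2 z.1) :
    slotsTOfRecord F N θ.ν θ.τ9 (EOfRecord₁₃ F N θ) (wOfRecord₉ F N θ.toStage9Params) θ.ppSel p (gOfRecord₁₃ F N θ p) 1 s = 0 ∨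
      ∀ᵐ V1 ∂fieldMeasure (F.P p.K) 1 (SU N),
        chiSeqOfRecord F N θ.ν θ.τ9.M (gOfRecord₁₃ F N θ p) p.K 1 s V1 ≠ 0 →
          slotsTOfRecord F N θ.ν θ.τ9 (EOfRecord₁₃ F N θ) (wOfRecord₉ F N θ.toStage9Params) θ.ppSel p
              (gOfRecord₁₃ F N θ p) 1 s V1 =
            sect2Slot F N (FluctV N) p.K (settingOfRecord₁₃ F N θ p) (θ.Rz p.K) W s t (EOfRecord₁₃ F N θ p) U V1 :=
  Or.inr (slotsT_one_ae_eq_sect2Slot_of_zeta0_pin θ p hK hM hζu s hΩ W t U hU Z hWζ hWw hZ hq hmw)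

end Pin

/-! ## §4. THE PIN'S LAWS: the function `ω ↦ w(s′)((ω 0).1, avg (ω 0).1)` is local at scale 0, nonnegative, at most one -/

section PinLaws

variable (θ : Stage13Params F N) (p : B12.RunParams)

/-- **THE PIN AT THE TWO-SCALE CONFIGURATION** reads `w(s′)(U, Ū)` (scale `0` of `pairCfg V₁ U` is `(U, 0)`) — so it satisfies §3's hypothesis `hZ`.
[cite: Balaban1988Convergent, (1.11) p.248, (2.21) p.258] -/
theorem stepWeightPin_pairCfg (s : SeqOfRecord F θ.ν θ.τ9.M (gOfRecord₁₃ F N θ p) p.K 1)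
    (V1 : GaugeField (F.P p.K) 1 (SU N)) (Uf : GaugeField (F.P p.K) 0 (SU N)) :
    (fun ω : MultiCfg (F.P p.K) (SU N) (FluctV N) =>
        wOfRecord₉ F N θ.toStage9Params p (gOfRecord₁₃ F N θ p) 0 s (ω 0).1 ((avOfRecord F N p.K 0).avg (ω 0).1))
      (pairCfg (V := FluctV N) V1 Uf) =
      wOfRecord₉ F N θ.toStage9Params p (gOfRecord₁₃ F N θ p) 0 s Uf ((avOfRecord F N p.K 0).avg Uf) := by
  simp only [pairCfg_zero]

/-- **THE PIN IS LOCAL AT SCALE 0** (12b's `TkResidualW.LocalLaws` shape at generation `0`: two configurations with the same scale-0 variables get the same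
value). [cite: Balaban1988Convergent, (3.2)–(3.3) p.265, p.267] -/
theorem stepWeightPin_local (s : SeqOfRecord F θ.ν θ.τ9.M (gOfRecord₁₃ F N θ p) p.K 1)
    (ω ω' : MultiCfg (F.P p.K) (SU N) (FluctV N)) (h : ω 0 = ω' 0) :
    wOfRecord₉ F N θ.toStage9Params p (gOfRecord₁₃ F N θ p) 0 s (ω 0).1 ((avOfRecord F N p.K 0).avg (ω 0).1) =
      wOfRecord₉ F N θ.toStage9Params p (gOfRecord₁₃ F N θ p) 0 s (ω' 0).1 ((avOfRecord F N p.K 0).avg (ω' 0).1) := by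
  rw [h]

/-- **THE PIN IS NONNEGATIVE** (12a's `TkResidualW.Laws` shape), under unity of def-T's residual `ζ` (this seat's `wOfRecord_nonneg_of_Omega_empty`).
[cite: Balaban1988Convergent, (3.2)–(3.3) p.265, (3.16) p.268] -/
theorem stepWeightPin_nonneg (hζu : IsZetaUnity F N θ.ν θ.τ9.M θ.ζ)
    (s : SeqOfRecord F θ.ν θ.τ9.M (gOfRecord₁₃ F N θ p) p.K 1) (hΩ : s.Ω 1 = ∅) (ω : MultiCfg (F.P p.K) (SU N) (FluctV N)) :
    0 ≤ wOfRecord₉ F N θ.toStage9Params p (gOfRecord₁₃ F N θ p) 0 s (ω 0).1 ((avOfRecord F N p.K 0).avg (ω 0).1) :=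
  wOfRecord_nonneg_of_Omega_empty F N θ.ν θ.τ9.M θ.A₁ p (gOfRecord₁₃ F N θ p) 0 hζu s hΩ _ _

/-- **THE PIN IS AT MOST ONE** (so the spec's bound `hB` holds with `B = 1`), under unity of def-T's residual `ζ` (`wOfRecord_le_one_of_Omega_empty`).
[cite: Balaban1988Convergent, (3.2)–(3.3) p.265, (3.16) p.268] -/
theorem stepWeightPin_le_one (hζu : IsZetaUnity F N θ.ν θ.τ9.M θ.ζ)
    (s : SeqOfRecord F θ.ν θ.τ9.M (gOfRecord₁₃ F N θ p) p.K 1) (hΩ : s.Ω 1 = ∅) (ω : MultiCfg (F.P p.K) (SU N) (FluctV N)) :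
    wOfRecord₉ F N θ.toStage9Params p (gOfRecord₁₃ F N θ p) 0 s (ω 0).1 ((avOfRecord F N p.K 0).avg (ω 0).1) ≤ 1 :=
  wOfRecord_le_one_of_Omega_empty F N θ.ν θ.τ9.M θ.A₁ p (gOfRecord₁₃ F N θ p) 0 hζu s hΩ _ _

end PinLaws

end Summit.QuantumFields.YangMills.Theorems.BalabanUVNodesN11NoExpansionZetaSpec

end
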